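import Summits.QuantumFields.BalabanUV.Beta.PropagatorWoodburyFibreReduction
import Literature.MathematicalPhysics.QuantumLattice.TransferOperatorDual

/-!
# Beta / PropagatorWoodburyFibreOpNorm — KING'S LEMMA 4.1 IN OPERATOR NORM for matrix fibres: `‖Δ_a(H) − Δ_a(H′)‖ ≤ a²·‖S(H′) − S(H)‖`,
# and the operator-norm sandwiches of the fluctuation covariance, the effective form and the minimiser (census V5 ∕ row (b) of
# `HOME/b2b-balaban-gan24-p3/WOODBURY-FIBRE.md` v2 — DONE)

Cell `pub-balaban`, β sub-cell, BINDER ROW **G-an2-4 ∕ (CONV-C)** (NOT IN PRINT), prover part **P3 = WOODBURY-FIBRE reduction**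
(unit `b2b-balaban-gan24-p3`, gen 2); third sibling of `PropagatorWoodburyFibre` (objects, KKT identity, composition law, deviation
identities) and `PropagatorWoodburyFibreReduction` (positivity, Loewner sizes).  HONEST FRAMING (verbatim): discharging `BetaPertH` makes
Bałaban's UV stability UNCONDITIONAL — a real constructive-QFT result; it is NOT the continuum limit and NOT the Clay problem.  (CONV-C) is
OPEN and NOT discharged here.  HONEST DEPENDENCY: continuum YM on T⁴ ⇐ BetaPertH ∧ nine spine estimates (0/9 proved); BetaPertH ⇐ (D1) ∧
(D4) ∧ CAP+tail; G-an2-4 gates asym, D1 and NE2/3/4.  ABSOLUTE RULE honoured: every declaration is `[folklore]` finite-dimensional linear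
algebra over `ℂ` (Mathlib `Matrix`, L²-operator norm `Matrix.Norms.L2Operator`, Loewner order); `[cite: …]` tags LOCATE the printed scalar
sentence whose matrix form is proved; nothing printed is a hypothesis.

WHAT IS PROVED (the NORM requested by the coordinator's return of 2026-08-19T23:22Z, row (b) «operator norm per fibre»):
* §1 Loewner order ⇒ operator norm: `0 ⪯ E ⪯ a·1 ⇒ ‖E‖ ≤ a` (`opNorm_le_of_posSemidef_of_sub_posSemidef`), `0 ⪯ A ⪯ B ⇒ ‖A‖ ≤ ‖B‖`
  (`opNorm_le_opNorm_of_posSemidef`) — via the tree's Rayleigh-quotient lemma `QuantumLattice.l2_opNorm_le_of_abs_re_le`.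
* §2 SIZES in operator norm: `‖Δ_a‖ ≤ a` (`opNorm_effFormSoft_le`, from `effFormSoft_posDef` + `effFormSoft_le`: King's «`Δ^{(k)}, Δ̄^{(k)} ≤ a_k`»
  [cite: King1986, proof of Lemma 4.1 p.671]); `0 ⪯ H⁻¹ − Γ` (`inv_sub_flucCov_posSemidef`: `H⁻¹ − Γ = ℋ·S·ℋᴴ`) hence `‖Γ(H)‖ ≤ ‖H⁻¹‖`
  (`opNorm_flucCov_le`).
* §3 KING'S LEMMA 4.1 ∕ 4.5 IN OPERATOR NORM on an arbitrary matrix fibre: `‖S(H′) − S(H)‖ ≤ ‖Q‖²·‖H⁻¹‖·‖H′⁻¹‖·‖H − H′‖` (`opNorm_pivot_sub_le`),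
  **`‖Δ_a(H) − Δ_a(H′)‖ ≤ a²·‖S(H′) − S(H)‖`** (`opNorm_effFormSoft_sub_le`; the scalar sentence is King's (4.11) «`|Δ − Δ̄| ≤ a²|Δ̄⁻¹ − Δ⁻¹|`»
  [cite: King1986, (4.11) p.671]) and its composite `≤ a²‖Q‖²‖H⁻¹‖‖H′⁻¹‖‖H − H′‖` (`opNorm_effFormSoft_sub_le'`); the hard-constraint form
  `‖Δ(H) − Δ(H′)‖ ≤ ‖Δ(H)‖·‖S(H′) − S(H)‖·‖Δ(H′)‖` (`opNorm_effForm_sub_le`); the covariance `‖Γ(H) − Γ(H′)‖ ≤ ‖H⁻¹‖·‖H′ − H‖·‖H′⁻¹‖`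
  (`opNorm_flucCov_sub_le`, King's (4.39)–(4.40) [cite: King1986, (4.39)–(4.40) p.674] in operator norm); the minimiser
  `‖ℋ(H) − ℋ(H′)‖ ≤ ‖H⁻¹‖·‖H′ − H‖·‖ℋ(H′)‖` (`opNorm_minimiser_sub_le`).
WHAT THIS IS FOR (census row (b)): per Bloch fibre, every block of the decimated one-step resolvent deviates from its limit by an operator-norm
amount controlled by ONE number, `‖S(H′) − S(H)‖` resp. `‖H − H′‖` of the fibre's effective form — the matrix replacement of King's scalar
`|Δ̄⁻¹ − Δ⁻¹|`.  NOT GIVEN: the passage operator-norm-per-fibre ⇒ position-space `Decays` (strip analyticity; gan24-p1's Part A); any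
instantiation on `BlochFibreMatrix` (gauge rows: `HOME/b2b-balaban-gan24-p3/WOODBURY-FIBRE.md` v2 §3 (a),(c)).
-/

noncomputable section

open Matrix
open scoped ComplexOrder MatrixOrder Matrix.Norms.L2Operator

namespace Summit.QuantumFields.BalabanUV.Beta.PropagatorWoodburyFibre

variable {m n : Type*} [Fintype m] [Fintype n] [DecidableEq m] [DecidableEq n]

/-! ## §1 Loewner order ⇒ L²-operator norm -/

/-- `0 ⪯ E` and `a·1 − E ⪰ 0` (`a ≥ 0`) give `‖E‖ ≤ a` in the L²-operator norm. [folklore] -/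
theorem opNorm_le_of_posSemidef_of_sub_posSemidef {E : Matrix m m ℂ} {a : ℝ} (ha : 0 ≤ a) (h0 : E.PosSemidef)
    (h1 : ((a : ℂ) • (1 : Matrix m m ℂ) - E).PosSemidef) : ‖E‖ ≤ a := by
  refine Literature.MathematicalPhysics.QuantumLattice.l2_opNorm_le_of_abs_re_le h0.isHermitian ha fun x => ?_
  have hlo : 0 ≤ (star x ⬝ᵥ E *ᵥ x).re := by simpa using h0.re_dotProduct_nonneg x
  have hhi : 0 ≤ (star x ⬝ᵥ ((a : ℂ) • (1 : Matrix m m ℂ) - E) *ᵥ x).re := by simpa using h1.re_dotProduct_nonneg x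
  rw [sub_mulVec, dotProduct_sub, Matrix.smul_mulVec, one_mulVec, dotProduct_smul, smul_eq_mul, Complex.sub_re,
    Complex.re_ofReal_mul] at hhi
  rw [abs_of_nonneg hlo]
  linarith

/-- Loewner monotonicity of the norm on the positive cone: `0 ⪯ A`, `B − A ⪰ 0 ⇒ ‖A‖ ≤ ‖B‖`. [folklore] -/
theorem opNorm_le_opNorm_of_posSemidef {A B : Matrix m m ℂ} (h0 : A.PosSemidef) (h1 : (B - A).PosSemidef) : ‖A‖ ≤ ‖B‖ := by
  refine opNorm_le_of_posSemidef_of_sub_posSemidef (norm_nonneg B) h0 ?_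
  have hB : B.IsHermitian := by
    have := h1.isHermitian.add h0.isHermitian
    simpa using this
  have h2 := Literature.MathematicalPhysics.QuantumLattice.posSemidef_norm_smul_one_sub hB
  have : (‖B‖ : ℂ) • (1 : Matrix m m ℂ) - A = ((‖B‖ : ℂ) • (1 : Matrix m m ℂ) - B) + (B - A) := by abel
  rw [this]
  exact h2.add h1

/-! ## §2 Sizes in operator norm -/

omit [DecidableEq m] in
/-- `0 < (a : ℂ)⁻¹` for `0 < a` (the `ComplexOrder` hypothesis shape of the sibling's soft-form lemmas). [folklore] -/
theorem inv_ofReal_pos {a : ℝ} (ha : 0 < a) : (0 : ℂ) < ((a : ℂ))⁻¹ := by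
  rw [← Complex.ofReal_inv]
  exact_mod_cast inv_pos.mpr ha

/-- **`‖Δ_a‖ ≤ a`**: the soft effective form of a positive-definite fibre has operator norm at most `a` (from `0 ≺ Δ_a`, `a·1 − Δ_a ⪰ 0`;
King's «`Δ^{(k)}, Δ̄^{(k)} ≤ a_k`» [cite: King1986, proof of Lemma 4.1 p.671] in operator norm). [folklore] -/
theorem opNorm_effFormSoft_le {H : Matrix n n ℂ} (hH : H.PosDef) (Q : Matrix m n ℂ) {a : ℝ} (ha : 0 < a) :
    ‖effFormSoft (a : ℂ) H Q‖ ≤ a :=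
  opNorm_le_of_posSemidef_of_sub_posSemidef ha.le (effFormSoft_posDef hH Q (inv_ofReal_pos ha)).posSemidef
    (effFormSoft_le hH Q (by exact_mod_cast ha) (inv_ofReal_pos ha))

/-- `H⁻¹ − Γ = ℋ·S·ℋᴴ` for Hermitian invertible `H` with invertible pivot (`S = QH⁻¹Qᴴ`, `ℋ = H⁻¹QᴴΔ`). [folklore] -/
theorem inv_sub_flucCov_eq {𝕜 : Type*} [Field 𝕜] [StarRing 𝕜] {H : Matrix n n 𝕜} {Q : Matrix m n 𝕜} (hHh : H.IsHermitian)
    (hP : IsUnit (pivot H Q)) : H⁻¹ - flucCov H Q = minimiser H Q * pivot H Q * (minimiser H Q)ᴴ := by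
  have hinv : (H⁻¹)ᴴ = H⁻¹ := by rw [conjTranspose_nonsing_inv, hHh.eq]
  rw [flucCov, sub_sub_cancel, minimiser, conjTranspose_mul, conjTranspose_mul, conjTranspose_conjTranspose, hinv,
    effForm_conjTranspose hHh]
  simp only [Matrix.mul_assoc]
  rw [← Matrix.mul_assoc (effForm H Q) (pivot H Q), effForm_mul_pivot hP, Matrix.one_mul]

/-- **`0 ⪯ H⁻¹ − Γ`** for `H ≻ 0` and independent constraint rows. [folklore] -/
theorem inv_sub_flucCov_posSemidef {H : Matrix n n ℂ} (hH : H.PosDef) {Q : Matrix m n ℂ} (hQ : Function.Injective Q.vecMul) :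
    (H⁻¹ - flucCov H Q).PosSemidef := by
  rw [inv_sub_flucCov_eq hH.isHermitian (isUnit_pivot_of_posDef hH hQ)]
  exact (pivot_posSemidef hH Q).mul_mul_conjTranspose_same _

/-- **`‖Γ(H)‖ ≤ ‖H⁻¹‖`**: the fluctuation covariance is dominated by the unconstrained one in operator norm. [folklore] -/
theorem opNorm_flucCov_le {H : Matrix n n ℂ} (hH : H.PosDef) {Q : Matrix m n ℂ} (hQ : Function.Injective Q.vecMul) :
    ‖flucCov H Q‖ ≤ ‖H⁻¹‖ :=
  opNorm_le_opNorm_of_posSemidef (flucCov_posSemidef hH hQ) (inv_sub_flucCov_posSemidef hH hQ)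

/-! ## §3 King's Lemma 4.1 ∕ 4.5 in operator norm on a matrix fibre -/

/-- **Deviation of the pivot in operator norm**: `‖S(H′) − S(H)‖ ≤ ‖Q‖²·‖H⁻¹‖·‖H′⁻¹‖·‖H − H′‖`. [folklore] -/
theorem opNorm_pivot_sub_le {H H' : Matrix n n ℂ} (hH : IsUnit H) (hH' : IsUnit H') (Q : Matrix m n ℂ) :
    ‖pivot H' Q - pivot H Q‖ ≤ ‖Q‖ ^ 2 * ‖H⁻¹‖ * ‖H'⁻¹‖ * ‖H - H'‖ := by
  rw [pivot_sub, inv_sub_inv_eq hH' hH]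
  calc ‖Q * (H'⁻¹ * (H - H') * H⁻¹) * Qᴴ‖ ≤ ‖Q * (H'⁻¹ * (H - H') * H⁻¹)‖ * ‖Qᴴ‖ := l2_opNorm_mul _ _
    _ ≤ ‖Q‖ * ‖H'⁻¹ * (H - H') * H⁻¹‖ * ‖Qᴴ‖ :=
        mul_le_mul_of_nonneg_right (l2_opNorm_mul _ _) (norm_nonneg _)
    _ ≤ ‖Q‖ * (‖H'⁻¹‖ * ‖H - H'‖ * ‖H⁻¹‖) * ‖Q‖ := by
        rw [l2_opNorm_conjTranspose]
        exact mul_le_mul_of_nonneg_right (mul_le_mul_of_nonneg_left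
          ((l2_opNorm_mul _ _).trans (mul_le_mul_of_nonneg_right (l2_opNorm_mul _ _) (norm_nonneg _))) (norm_nonneg _))
          (norm_nonneg _)
    _ = ‖Q‖ ^ 2 * ‖H⁻¹‖ * ‖H'⁻¹‖ * ‖H - H'‖ := by ring

/-- **KING'S LEMMA 4.1 IN OPERATOR NORM (matrix fibre)**: `‖Δ_a(H) − Δ_a(H′)‖ ≤ a²·‖S(H′) − S(H)‖` for positive-definite fibres `H, H′` and
`a > 0` — the identity `effFormSoft_sub` (King's (4.11) «`Δ − Δ̄ = Δ(Δ̄⁻¹ − Δ⁻¹)Δ̄`, so `|Δ − Δ̄| ≤ a²|Δ̄⁻¹ − Δ⁻¹|`» [cite: King1986, (4.11) p.671])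
and the sizes `‖Δ_a‖, ‖Δ_a′‖ ≤ a`. [folklore] -/
theorem opNorm_effFormSoft_sub_le {H H' : Matrix n n ℂ} (hH : H.PosDef) (hH' : H'.PosDef) (Q : Matrix m n ℂ) {a : ℝ} (ha : 0 < a) :
    ‖effFormSoft (a : ℂ) H Q - effFormSoft (a : ℂ) H' Q‖ ≤ a ^ 2 * ‖pivot H' Q - pivot H Q‖ := by
  have hai := inv_ofReal_pos ha
  rw [effFormSoft_sub (isUnit_softPivot hH Q hai) (isUnit_softPivot hH' Q hai)]
  have h1 := opNorm_effFormSoft_le hH Q ha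
  have h2 := opNorm_effFormSoft_le hH' Q ha
  calc ‖effFormSoft (a : ℂ) H Q * (pivot H' Q - pivot H Q) * effFormSoft (a : ℂ) H' Q‖
      ≤ ‖effFormSoft (a : ℂ) H Q * (pivot H' Q - pivot H Q)‖ * ‖effFormSoft (a : ℂ) H' Q‖ := l2_opNorm_mul _ _
    _ ≤ ‖effFormSoft (a : ℂ) H Q‖ * ‖pivot H' Q - pivot H Q‖ * ‖effFormSoft (a : ℂ) H' Q‖ :=
        mul_le_mul_of_nonneg_right (l2_opNorm_mul _ _) (norm_nonneg _)
    _ ≤ a * ‖pivot H' Q - pivot H Q‖ * a :=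
        mul_le_mul (mul_le_mul_of_nonneg_right h1 (norm_nonneg _)) h2 (norm_nonneg _) (by positivity)
    _ = a ^ 2 * ‖pivot H' Q - pivot H Q‖ := by ring

/-- The composite form: `‖Δ_a(H) − Δ_a(H′)‖ ≤ a²·‖Q‖²·‖H⁻¹‖·‖H′⁻¹‖·‖H − H′‖`. [folklore] -/
theorem opNorm_effFormSoft_sub_le' {H H' : Matrix n n ℂ} (hH : H.PosDef) (hH' : H'.PosDef) (Q : Matrix m n ℂ) {a : ℝ} (ha : 0 < a) :
    ‖effFormSoft (a : ℂ) H Q - effFormSoft (a : ℂ) H' Q‖ ≤ a ^ 2 * (‖Q‖ ^ 2 * ‖H⁻¹‖ * ‖H'⁻¹‖ * ‖H - H'‖) :=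
  (opNorm_effFormSoft_sub_le hH hH' Q ha).trans (mul_le_mul_of_nonneg_left (opNorm_pivot_sub_le hH.isUnit hH'.isUnit Q) (sq_nonneg a))

/-- Hard constraints: `‖Δ(H) − Δ(H′)‖ ≤ ‖Δ(H)‖·‖S(H′) − S(H)‖·‖Δ(H′)‖` (the two sizes stay symbolic: they are the fibre's coercivity
constants, (2.157)-type inputs). [folklore] -/
theorem opNorm_effForm_sub_le {H H' : Matrix n n ℂ} {Q : Matrix m n ℂ} (hP : IsUnit (pivot H Q)) (hP' : IsUnit (pivot H' Q)) :
    ‖effForm H Q - effForm H' Q‖ ≤ ‖effForm H Q‖ * ‖pivot H' Q - pivot H Q‖ * ‖effForm H' Q‖ := by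
  rw [effForm_sub hP hP']
  exact (l2_opNorm_mul _ _).trans (mul_le_mul_of_nonneg_right (l2_opNorm_mul _ _) (norm_nonneg _))

/-- **The fluctuation covariance in operator norm** (King's (4.39)–(4.40) [cite: King1986, (4.39)–(4.40) p.674], matrix fibre):
`‖Γ(H) − Γ(H′)‖ ≤ ‖H⁻¹‖·‖H′ − H‖·‖H′⁻¹‖`. [folklore] -/
theorem opNorm_flucCov_sub_le {H H' : Matrix n n ℂ} (hH : H.PosDef) (hH' : H'.PosDef) {Q : Matrix m n ℂ}
    (hQ : Function.Injective Q.vecMul) : ‖flucCov H Q - flucCov H' Q‖ ≤ ‖H⁻¹‖ * ‖H' - H‖ * ‖H'⁻¹‖ := by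
  rw [flucCov_sub hH.isUnit hH'.isUnit (isUnit_pivot_of_posDef hH hQ) (isUnit_pivot_of_posDef hH' hQ)]
  have h1 := opNorm_flucCov_le hH hQ
  have h2 := opNorm_flucCov_le hH' hQ
  calc ‖flucCov H Q * (H' - H) * flucCov H' Q‖ ≤ ‖flucCov H Q * (H' - H)‖ * ‖flucCov H' Q‖ := l2_opNorm_mul _ _
    _ ≤ ‖flucCov H Q‖ * ‖H' - H‖ * ‖flucCov H' Q‖ :=
        mul_le_mul_of_nonneg_right (l2_opNorm_mul _ _) (norm_nonneg _)
    _ ≤ ‖H⁻¹‖ * ‖H' - H‖ * ‖H'⁻¹‖ :=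
        mul_le_mul (mul_le_mul_of_nonneg_right h1 (norm_nonneg _)) h2 (norm_nonneg _) (by positivity)

/-- The minimiser: `‖ℋ(H) − ℋ(H′)‖ ≤ ‖H⁻¹‖·‖H′ − H‖·‖ℋ(H′)‖`. [folklore] -/
theorem opNorm_minimiser_sub_le {H H' : Matrix n n ℂ} (hH : H.PosDef) (hH' : H'.PosDef) {Q : Matrix m n ℂ}
    (hQ : Function.Injective Q.vecMul) :
    ‖minimiser H Q - minimiser H' Q‖ ≤ ‖H⁻¹‖ * ‖H' - H‖ * ‖minimiser H' Q‖ := by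
  rw [minimiser_sub hH.isUnit hH'.isUnit (isUnit_pivot_of_posDef hH hQ) (isUnit_pivot_of_posDef hH' hQ)]
  have h1 := opNorm_flucCov_le hH hQ
  calc ‖flucCov H Q * (H' - H) * minimiser H' Q‖ ≤ ‖flucCov H Q * (H' - H)‖ * ‖minimiser H' Q‖ := l2_opNorm_mul _ _
    _ ≤ ‖flucCov H Q‖ * ‖H' - H‖ * ‖minimiser H' Q‖ :=
        mul_le_mul_of_nonneg_right (l2_opNorm_mul _ _) (norm_nonneg _)
    _ ≤ ‖H⁻¹‖ * ‖H' - H‖ * ‖minimiser H' Q‖ :=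
        mul_le_mul_of_nonneg_right (mul_le_mul_of_nonneg_right h1 (norm_nonneg _)) (norm_nonneg _)

end Summit.QuantumFields.BalabanUV.Beta.PropagatorWoodburyFibre

end
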